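import Summits.QuantumFields.YangMills.Theorems.BalabanUVNodesPortS1FWPieces

/-!
# Bałaban UV nodes port — S₃ helper: the piece family over NORMED carriers (new leaf; the generic twin of ✓`…PortS1FWPieces` §2)

Support file for ⟨stmt-QuantumFields-27930⟩ (`Lines/pta_residueW.lean`, stub S₃ `stub_FEpolymerActivitiesReg`), node A of the S₃ assembly (the F_W construction
(C-FW)⁺).  The tree's ✓`FWPieces.pieceFamily supp T s := Σ_ω (∏_{Δ ∈ supp ω} s Δ) • T_ω` (print's s-insertion, [II] p.3 L31–35) is typed for operators between Pi
types `(ι₁ → ℂ) →L[ℂ] (ι₂ → ℂ)`; the S₃ assembly (★★★ №670: the lit (77)∕(115) carriers `Space115Lit`∕`NegSize`∕`NegSizeLit` of [15]) needs the SAME construction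
and the SAME six carrier-blind rows for operators `E₁ →L[ℂ] E₂` between arbitrary complex normed spaces.  A landed statement is never re-typed in place (gate
`theorems.append-only`; ▶ PTC-1 dry-run nodeO STATUS 2026-08-31T22:46:53Z; ◆ CRIT-1 g41 shape ruling (α) 22:51:58Z), so the generic decls live HERE under NEW names:
`pieceFamilyN` + R1 `pieceFamilyN_one` + (L3)-engine `pieceFamilyN_congr` + `pieceFamilyN_eq_sum_filter` + R4 `differentiable_pieceFamilyN` ∕ `norm_pieceFamilyN_le` ∕
`bounds_pieceFamilyN` — bodies = ◆'s J24-stamped v29.3 (cd9b3ce2297998e6) verbatim up to the names — and the DECLARE-ONCE HONESTY FACE `pieceFamily_eq_pieceFamilyN`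
(`rfl`): the landed Pi-typed ✓`pieceFamily` IS `pieceFamilyN` at `E₁ := ι₁ → ℂ, E₂ := ι₂ → ℂ`, so the entrywise rows ✓`pieceFamily_apply_single` ∕ (L1)(L2)
✓`cubeDecoupled_pieceFamily` ∕ ✓`Covers` need no twins (consumers rewrite along the face).  Everything else (`SuppJoined`, `CubeDecoupled`, `SuppConnected`,
`suppJoined_of_conn`, `Covers`, `prod_eq_zero_of_mem`, `differentiable_finset_prod_apply`, `CubeFaceAdj`) is the tree's, imported, untouched.

HONEST: finite sums and products of continuous linear maps; no operator of [13]∕[15]∕[II] is constructed and no Bałaban estimate is proved; nothing at the record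
is inhabited; COUNT-NEUTRAL (`--supports stmt-QuantumFields-27930 --as helper`); finite 𝕋⁴ at fixed ε — not continuum ∕ OS ∕ Clay; the Yang–Mills mass gap is NOT
proved.  Author ◇ lens-1 g18 (v29.4 = v29.3's content in shape (α)).
[cite: Balaban1988RG2Cluster, (1.6)–(1.7) p.3, p.3 L31–36, (1.8)–(1.10) p.4, (1.11) p.5]
-/

noncomputable section

open scoped BigOperators

namespace Summit.QuantumFields.YangMills.Theorems.BalabanUVNodesPortS1.FWPiecesNormed

open Summit.QuantumFields.YangMills.Theorems.BalabanUVNodesPortS1.FHInterface (sPolydisc)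
open Summit.QuantumFields.YangMills.Theorems.BalabanUVNodesPortS1.FWPieces

variable {σ Ω : Type*} [Fintype Ω]
variable {E₁ E₂ : Type*} [NormedAddCommGroup E₁] [NormedSpace ℂ E₁] [NormedAddCommGroup E₂] [NormedSpace ℂ E₂]

/-! ## §1  The piece family over normed carriers and its declare-once face -/

/-- **Print's s-insertion over a decomposition into pieces, between arbitrary complex normed carriers**: `Σ_ω (∏_{Δ ∈ supp ω} s Δ) • T_ω` («we multiply the term
in (1.6) corresponding to ω by ∏ s(Δ_i)» over the σ₀-cubes meeting its localization domain) — the tree's ✓`FWPieces.pieceFamily` with the Pi carriers replaced by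
`E₁, E₂` (the lit (77)∕(115) spaces included). [cite: Balaban1988RG2Cluster, p.3 L31–35, (1.6) p.3] -/
def pieceFamilyN (supp : Ω → Finset σ) (T : Ω → (E₁ →L[ℂ] E₂)) (s : σ → ℂ) : E₁ →L[ℂ] E₂ :=
  ∑ ω, (∏ Δ ∈ supp ω, s Δ) • T ω

/-- **DECLARE-ONCE FACE**: the landed Pi-typed ✓`FWPieces.pieceFamily` IS `pieceFamilyN` at the Pi carriers — one construction, not a twin; the entrywise rows
✓`pieceFamily_apply_single`, ✓`cubeDecoupled_pieceFamily` transfer along this face. [cite: Balaban1988RG2Cluster, p.3 L31–35 (bookkeeping)] -/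
theorem pieceFamily_eq_pieceFamilyN {ι₁ ι₂ : Type*} [Fintype ι₁] [Fintype ι₂] (supp : Ω → Finset σ) (T : Ω → ((ι₁ → ℂ) →L[ℂ] (ι₂ → ℂ))) :
    pieceFamily supp T = pieceFamilyN supp T := rfl

/-- R1: **at `s = 1` the family is the full operator `Σ_ω T_ω`** («They coincide with the original ones for s = 1», p.3 L35–36). [cite: Balaban1988RG2Cluster, p.3 L35–36] -/
theorem pieceFamilyN_one (supp : Ω → Finset σ) (T : Ω → (E₁ →L[ℂ] E₂)) : pieceFamilyN supp T 1 = ∑ ω, T ω := by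
  simp [pieceFamilyN]

/-- (L3)'s engine: **pieces agreeing off the zeros of `s` give the same operator at `s`** (at the record: `T = T(U)`, `T′ = T(U′)` for backgrounds agreeing near
`supp s`, each piece U-local to its support — p.3 L14–16). [cite: Balaban1988RG2Cluster, p.3 L14–16, p.4 L30–38] -/
theorem pieceFamilyN_congr (supp : Ω → Finset σ) {T T' : Ω → (E₁ →L[ℂ] E₂)} (s : σ → ℂ)
    (h : ∀ ω, (∀ Δ ∈ supp ω, s Δ ≠ 0) → T ω = T' ω) : pieceFamilyN supp T s = pieceFamilyN supp T' s := by
  unfold pieceFamilyN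
  refine Finset.sum_congr rfl fun ω _ => ?_
  rcases em (∃ Δ ∈ supp ω, s Δ = 0) with ⟨Δ, hΔ, h0⟩ | hz
  · rw [prod_eq_zero_of_mem hΔ h0]
    exact (zero_smul ℂ (T ω)).trans (zero_smul ℂ (T' ω)).symm
  · rw [h ω fun Δ hΔ h0 => hz ⟨Δ, hΔ, h0⟩]

open scoped Classical in
/-- A piece whose support is NOT inside `{s ≠ 0}` contributes nothing — `pieceFamilyN … s` «depends on the pieces restricted to the support of s» (p.4 L30–38,
operator half). [cite: Balaban1988RG2Cluster, p.4 L30–38] -/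
theorem pieceFamilyN_eq_sum_filter (supp : Ω → Finset σ) (T : Ω → (E₁ →L[ℂ] E₂)) (s : σ → ℂ) :
    pieceFamilyN supp T s = ∑ ω ∈ Finset.univ.filter (fun ω => ∀ Δ ∈ supp ω, s Δ ≠ 0), (∏ Δ ∈ supp ω, s Δ) • T ω := by
  unfold pieceFamilyN
  rw [Finset.sum_filter]
  refine Finset.sum_congr rfl fun ω _ => ?_
  split_ifs with h
  · rfl
  · obtain ⟨Δ, hΔ, h0⟩ : ∃ Δ ∈ supp ω, s Δ = 0 := by
      by_contra hc
      exact h fun Δ hΔ h0 => hc ⟨Δ, hΔ, h0⟩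
    rw [prod_eq_zero_of_mem hΔ h0]
    exact zero_smul ℂ (T ω)

/-! ## §2  R4 — (1.11): entire in `s`, bounded on the big polydisc from the weighted summability of the pieces -/

variable [Fintype σ]

/-- R4a: **the piece family is ENTIRE in `s`** (a polynomial with operator coefficients). [cite: Balaban1988RG2Cluster, (1.11) p.5] -/
theorem differentiable_pieceFamilyN (supp : Ω → Finset σ) (T : Ω → (E₁ →L[ℂ] E₂)) :
    Differentiable ℂ (pieceFamilyN supp T) := by
  show Differentiable ℂ (fun s : σ → ℂ => ∑ ω, (∏ Δ ∈ supp ω, s Δ) • T ω)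
  exact Differentiable.fun_sum fun ω _ => (differentiable_finset_prod_apply (supp ω)).smul (differentiable_const _)

omit [Fintype σ] in
/-- R4b: **the (1.11)-shape BOUND on the big polydisc from SUMMABILITY OF THE PIECES with weight `e^{κ₁|supp ω|}`** ((1.7)∕[13] (3.108): «the first two
factors in (1.7) are used to control the sum over ω, and they determine the constant B₀»). [cite: Balaban1988RG2Cluster, (1.7) p.3, (1.11) p.5] -/
theorem norm_pieceFamilyN_le (supp : Ω → Finset σ) (T : Ω → (E₁ →L[ℂ] E₂)) {κ₁ B : ℝ}
    (hB : ∑ ω, ‖T ω‖ * Real.exp κ₁ ^ (supp ω).card ≤ B) {s : σ → ℂ} (hs : s ∈ sPolydisc σ (Real.exp κ₁)) :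
    ‖pieceFamilyN supp T s‖ ≤ B := by
  have hs' : ∀ Δ, ‖s Δ‖ < Real.exp κ₁ := hs
  unfold pieceFamilyN
  calc ‖∑ ω, (∏ Δ ∈ supp ω, s Δ) • T ω‖ ≤ ∑ ω, ‖(∏ Δ ∈ supp ω, s Δ) • T ω‖ := norm_sum_le _ _
    _ ≤ ∑ ω, ‖T ω‖ * Real.exp κ₁ ^ (supp ω).card := by
        refine Finset.sum_le_sum fun ω _ => ?_
        rw [norm_smul, Complex.norm_prod, mul_comm]
        refine mul_le_mul_of_nonneg_left ?_ (norm_nonneg _)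
        calc ∏ Δ ∈ supp ω, ‖s Δ‖ ≤ ∏ _Δ ∈ supp ω, Real.exp κ₁ :=
              Finset.prod_le_prod (fun _ _ => norm_nonneg _) fun Δ _ => (hs' Δ).le
          _ = Real.exp κ₁ ^ (supp ω).card := Finset.prod_const _
    _ ≤ B := hB

/-- R4: **the (1.11) row** for the piece family, in print's and the interface's spelling (✓`DecoupledOps.Bounds`: `‖·‖ ≤ B₀·e^{16κ₁}` on `|s(Δ)| < e^{κ₁}`):
from `Σ_ω ‖T_ω‖ e^{κ₁|supp ω|} ≤ B₀e^{16κ₁}` (p.3 L21–23, p.5 L13–19) the family is analytic on `sPolydisc σ (e^{κ₁})` and bounded by `B₀e^{16κ₁}` there.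
[cite: Balaban1988RG2Cluster, (1.11) p.5, (1.7) p.3] -/
theorem bounds_pieceFamilyN (supp : Ω → Finset σ) (T : Ω → (E₁ →L[ℂ] E₂)) {κ₁ B₀ : ℝ}
    (hB : ∑ ω, ‖T ω‖ * Real.exp κ₁ ^ (supp ω).card ≤ B₀ * Real.exp (16 * κ₁)) :
    DifferentiableOn ℂ (pieceFamilyN supp T) (sPolydisc σ (Real.exp κ₁)) ∧
      ∀ s ∈ sPolydisc σ (Real.exp κ₁), ‖pieceFamilyN supp T s‖ ≤ B₀ * Real.exp (16 * κ₁) :=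
  ⟨(differentiable_pieceFamilyN supp T).differentiableOn, fun _ hs => norm_pieceFamilyN_le supp T hB hs⟩

end Summit.QuantumFields.YangMills.Theorems.BalabanUVNodesPortS1.FWPiecesNormed

end
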